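import Mathlib
import HarnessLib
import Summits.HubbardSuperconductivity.HubbardSuperconductivity.Theorems.KLProgrammeKLRegimeSplitEdgeFactsRelativeLines
import Summits.HubbardSuperconductivity.HubbardSuperconductivity.Theorems.KLProgrammeKLRegimeWickScaleFlowLines

/-!
# Route `KLProgramme` — ENGINE child gen 8 (stmt-HubbardSuperconductivity-20437 `KLRegimeEngineV17F2`), skeleton v2 class #5 rev 3 «relative family» (plan g20 (R54f)/(R54g) G1):
# the RUNNING smeared weight of a member along a slice and its fundamental-theorem identification with `klSliceWeightSmeared` — the continuous rung the relative
# door integrates (cell gate-hubbard-kl, seat hubbard-kl-p1 g12 = EdgeFacts lane; input of k3c1-p1's `kltc_relative_step_fwd`, p584594, hypotheses `hb_i`/`ha`/`hρ_i`/`hβ_i`)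

WHY.  On the continuous route the member `ψ` of slice `n+1` is Wick-ordered w.r.t. the running soft covariance with symbol
`φ_Λ := ψ + (w_{Λ_{n+1}} − w_Λ)` (`Λ ∈ [Λ_{n+1}, Λ_n]`; `φ_{Λ_{n+1}} = ψ`, `φ_{Λ_n} = ψ + s_{n+1}` = the history member), its pp rung has the line pair
`(ẇ_Λ·βL²ĝ_K, φ_Λ·βL²ĝ_K)` (`…WickScaleFlowLines`, `bubbleSum_pp_pairKernel_wickActionR`), i.e. — frequency-aggregated in the `z′` currency of `klBubbleMass` — the rate
`B(ẇ_Λ, φ_Λ) + B(φ_Λ, ẇ_Λ) = −d/dΛ B(φ_Λ, φ_Λ)`.  So the CUMULATIVE rung of the member's tower over the slice is `B(φ_{Λ_n},φ_{Λ_n}) − B(φ_{Λ_{n+1}},φ_{Λ_{n+1}}) =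
klSliceWeightSmeared … (n+1) ψ` EXACTLY (the weight of the conservation identities p577392/p584715), and the RELATIVE rate of two members `ψ₁, ψ₂` is
`−d/dΛ [B(φ¹_Λ,φ¹_Λ) − B(φ²_Λ,φ²_Λ)] = B(ẇ_Λ, D) + B(D, ẇ_Λ)`, `D = ψ₁ − ψ₂` — lines of the DIFFERENCE symbol only, mass `≤ (βL²)⁻¹·2·sup(|ẇ_Λ|‖ĝ_K‖)·Σ|D|‖ĝ_K‖`.
* §1 `klBubbleMass_eq_real_sum` (the pair mass as a REAL finite sum `(βL²)⁻¹Σ_ν a(ν,p)b(ν̄,q)·Re(ĝĝ′)`), **`hasDerivAt_klBubbleMass`** (product rule in two Λ-dependent symbols);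
* §2 the running symbol: `hasDerivAt_runningSymbol` (`d/dΛ φ_Λ = −ẇ_Λ`), **`hasDerivAt_runningSmearedWeight`** (`d/dΛ B(φ_Λ,φ_Λ) = −[B(ẇ_Λ,φ_Λ) + B(φ_Λ,ẇ_Λ)]`),
  `runningSymbol_at_lower/_upper` (endpoints), **`runningSmearedWeight_upper_sub_lower`** (`= klSliceWeightSmeared … (n+1) ψ`);
* §3 RELATIVE: **`hasDerivAt_runningSmearedWeight_sub`** (`d/dΛ [B(φ¹,φ¹) − B(φ²,φ²)] = −[B(ẇ_Λ,D) + B(D,ẇ_Λ)]`), `abs_derivWeight_mul_norm_propCT_le`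
  (`|ẇ_Λ(k)|·‖ĝ_K(k)‖ ≤ (128/3)/Λ²` on the shell, `0 < Λ`), **`sum_abs_relativeRate_le_softSum`** (`Σ_p |B(ẇ_Λ,D)+B(D,ẇ_Λ)| ≤ (βL²)⁻¹·(256/3)/Λ²·Σ_k |D|‖ĝ_K‖`).
Exact calculus on the model symbols + the landed bubble-mass bounds; nothing about the effective action is asserted; nothing asserts superconductivity.  0 kit.
-/

noncomputable section

namespace Summit.HubbardSuperconductivity.HubbardSuperconductivity.Theorems.KLRegimeSplit

set_option linter.dupNamespace false -- summit = problem name (single-conjunct summit), D-0017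

open Real Finset Complex Literature.MathematicalPhysics.QuantumLattice Literature.Probability.LatticeModels
open Summit.HubbardSuperconductivity.HubbardSuperconductivity.Theorems.KLProgrammeLegKernels
open Summit.HubbardSuperconductivity.HubbardSuperconductivity.Theorems.TwoPointAssembly
open Summit.HubbardSuperconductivity.HubbardSuperconductivity.Theorems.KLRegimeWick

/-! ## §1 The pair mass as a real finite sum; the product rule in the two symbols -/

section Calculus

variable {L M : ℕ} (β μ : ℝ) (K : TrigPolyC4v)

/-- **The pair mass is a REAL finite sum**: `B(a,b)(Qm,p) = (βL²)⁻¹·Σ_ν a(ν,p)·b(ν̄,Qm−p)·Re(ĝ_K(ν,p)ĝ_K(ν̄,Qm−p))`. -/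
theorem klBubbleMass_eq_real_sum (a b : FreqMomentum L M → ℝ) (Qm p : TorusSite 2 L) :
    klBubbleMass L M β μ K a b Qm p =
      (β * (L : ℝ) ^ 2)⁻¹ * ∑ ν : MatsubaraIdx M,
        a (ν, p) * b (ν.rev, Qm - p) * (propCT L M β μ K (ν, p) * propCT L M β μ K (ν.rev, Qm - p)).re := by
  rw [klBubbleMass, klBubbleSum, Complex.re_sum]
  congr 1
  refine sum_congr rfl fun ν _ => ?_
  rw [Complex.re_ofReal_mul]

/-- **Product rule**: if the two symbols depend differentiably on a real parameter `Λ` (pointwise), then so does the pair mass, with derivative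
`B(a′, b) + B(a, b′)`. -/
theorem hasDerivAt_klBubbleMass {a b : ℝ → FreqMomentum L M → ℝ} {a' b' : FreqMomentum L M → ℝ} {Λ : ℝ}
    (ha : ∀ k, HasDerivAt (fun Λ' => a Λ' k) (a' k) Λ) (hb : ∀ k, HasDerivAt (fun Λ' => b Λ' k) (b' k) Λ) (Qm p : TorusSite 2 L) :
    HasDerivAt (fun Λ' => klBubbleMass L M β μ K (a Λ') (b Λ') Qm p)
      (klBubbleMass L M β μ K a' (b Λ) Qm p + klBubbleMass L M β μ K (a Λ) b' Qm p) Λ := by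
  simp only [klBubbleMass_eq_real_sum]
  rw [← mul_add, ← sum_add_distrib]
  refine HasDerivAt.const_mul _ (HasDerivAt.fun_sum fun ν _ => ?_)
  have h := ((ha (ν, p)).mul (hb (ν.rev, Qm - p))).mul_const ((propCT L M β μ K (ν, p) * propCT L M β μ K (ν.rev, Qm - p)).re)
  refine h.congr_deriv ?_
  ring

/-- `B(−a, b) = −B(a, b)`. -/
theorem klBubbleMass_neg_left (a b : FreqMomentum L M → ℝ) (Qm p : TorusSite 2 L) :
    klBubbleMass L M β μ K (-a) b Qm p = -klBubbleMass L M β μ K a b Qm p := by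
  have h := klBubbleMass_add_left β μ K a (-a) b Qm p
  rw [add_neg_cancel] at h
  have h0 : klBubbleMass L M β μ K (0 : FreqMomentum L M → ℝ) b Qm p = 0 := by simp [klBubbleMass, klBubbleSum]
  rw [h0] at h; linarith

/-- `B(a, −b) = −B(a, b)`. -/
theorem klBubbleMass_neg_right (a b : FreqMomentum L M → ℝ) (Qm p : TorusSite 2 L) :
    klBubbleMass L M β μ K a (-b) Qm p = -klBubbleMass L M β μ K a b Qm p := by
  have h := klBubbleMass_add_right β μ K a b (-b) Qm p
  rw [add_neg_cancel] at h
  have h0 : klBubbleMass L M β μ K a (0 : FreqMomentum L M → ℝ) Qm p = 0 := by simp [klBubbleMass, klBubbleSum]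
  rw [h0] at h; linarith

end Calculus

/-! ## §2 The running soft symbol of a member along slice `n+1` and its smeared weight -/

section Running

variable {L M : ℕ} (β μ : ℝ) (K : TrigPolyC4v)

/-- **The running symbol moves by the derivative weight**: `d/dΛ [ψ + (w_{Λ₁} − w_Λ)](k) = −ẇ_Λ(k)` (`Λ ≠ 0`; `ẇ_Λ(k) := deriv (Λ′ ↦ w_{Λ′}(k)) Λ`). -/
theorem hasDerivAt_runningSymbol {Λ : ℝ} (hΛ : Λ ≠ 0) (Λ₁ : ℝ) (ψ : FreqMomentum L M → ℝ) (k : FreqMomentum L M) :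
    HasDerivAt (fun Λ' => ψ k + (hubbardCutoffWeightCT L M β μ K Λ₁ k - hubbardCutoffWeightCT L M β μ K Λ' k))
      (-deriv (fun Λ' => hubbardCutoffWeightCT L M β μ K Λ' k) Λ) Λ := by
  have h := (klws_hasDerivAt_cutoffWeight_scale L M β μ K hΛ k)
  have h' : HasDerivAt (fun Λ' => hubbardCutoffWeightCT L M β μ K Λ' k) (deriv (fun Λ' => hubbardCutoffWeightCT L M β μ K Λ' k) Λ) Λ := by
    rw [h.deriv]; exact h
  exact (h'.const_sub (ψ k + hubbardCutoffWeightCT L M β μ K Λ₁ k)).congr_of_eventuallyEq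
    (Filter.Eventually.of_forall fun Λ' => by simp only; ring)

/-- **The running smeared weight's scale derivative**: with `φ_Λ := ψ + (w_{Λ₁} − w_Λ)`,
`d/dΛ B(φ_Λ, φ_Λ)(Qm,p) = −[B(ẇ_Λ, φ_Λ) + B(φ_Λ, ẇ_Λ)](Qm,p)` — minus the frequency-aggregated pp rung of the member at cutoff `Λ` (line pair `(ẇ_Λ, φ_Λ)`). -/
theorem hasDerivAt_runningSmearedWeight {Λ : ℝ} (hΛ : Λ ≠ 0) (Λ₁ : ℝ) (ψ : FreqMomentum L M → ℝ) (Qm p : TorusSite 2 L) :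
    HasDerivAt
      (fun Λ' => klBubbleMass L M β μ K
        (fun k => ψ k + (hubbardCutoffWeightCT L M β μ K Λ₁ k - hubbardCutoffWeightCT L M β μ K Λ' k))
        (fun k => ψ k + (hubbardCutoffWeightCT L M β μ K Λ₁ k - hubbardCutoffWeightCT L M β μ K Λ' k)) Qm p)
      (-(klBubbleMass L M β μ K (fun k => deriv (fun Λ' => hubbardCutoffWeightCT L M β μ K Λ' k) Λ)
            (fun k => ψ k + (hubbardCutoffWeightCT L M β μ K Λ₁ k - hubbardCutoffWeightCT L M β μ K Λ k)) Qm p +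
          klBubbleMass L M β μ K (fun k => ψ k + (hubbardCutoffWeightCT L M β μ K Λ₁ k - hubbardCutoffWeightCT L M β μ K Λ k))
            (fun k => deriv (fun Λ' => hubbardCutoffWeightCT L M β μ K Λ' k) Λ) Qm p)) Λ := by
  have h := hasDerivAt_klBubbleMass β μ K (hasDerivAt_runningSymbol β μ K hΛ Λ₁ ψ) (hasDerivAt_runningSymbol β μ K hΛ Λ₁ ψ) Qm p
  refine h.congr_deriv ?_
  -- `B(−ẇ, φ) + B(φ, −ẇ) = −(B(ẇ,φ) + B(φ,ẇ))`
  have hneg : (fun k => -deriv (fun Λ' => hubbardCutoffWeightCT L M β μ K Λ' k) Λ) =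
      -(fun k => deriv (fun Λ' => hubbardCutoffWeightCT L M β μ K Λ' k) Λ) := rfl
  rw [hneg, klBubbleMass_neg_left, klBubbleMass_neg_right]
  ring

/-- At the LOWER end `Λ = Λ₁` the running symbol is the member itself: `φ_{Λ₁} = ψ`. -/
theorem runningSymbol_at_lower (Λ₁ : ℝ) (ψ : FreqMomentum L M → ℝ) :
    (fun k => ψ k + (hubbardCutoffWeightCT L M β μ K Λ₁ k - hubbardCutoffWeightCT L M β μ K Λ₁ k)) = ψ := by
  funext k; simp

/-- At the UPPER end `Λ = Λ_n` (with `Λ₁ = Λ_{n+1}`) the running symbol is the HISTORY member: `φ_{Λ_n} = ψ + s_{n+1}`. -/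
theorem runningSymbol_at_upper (n : ℕ) (ψ : FreqMomentum L M → ℝ) :
    (fun k => ψ k + (hubbardCutoffWeightCT L M β μ K (klScale klE0 (n + 1)) k - hubbardCutoffWeightCT L M β μ K (klScale klE0 n) k)) =
      ψ + softSymbolCompl L M β μ K n (n + 1) := by
  funext k; simp [softSymbolCompl]

/-- **FTC endpoints = the smeared slice weight**: `B(φ_{Λ_n},φ_{Λ_n}) − B(φ_{Λ_{n+1}},φ_{Λ_{n+1}}) = klSliceWeightSmeared … (n+1) ψ` — the cumulative rung of the member's
tower over slice `n+1` IS the model weight of the conservation identities (`klTransferWeight_succ`, `klTransferWeight_sub_succ`). -/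
theorem runningSmearedWeight_upper_sub_lower (n : ℕ) (ψ : FreqMomentum L M → ℝ) (Qm p : TorusSite 2 L) :
    klBubbleMass L M β μ K
        (fun k => ψ k + (hubbardCutoffWeightCT L M β μ K (klScale klE0 (n + 1)) k - hubbardCutoffWeightCT L M β μ K (klScale klE0 n) k))
        (fun k => ψ k + (hubbardCutoffWeightCT L M β μ K (klScale klE0 (n + 1)) k - hubbardCutoffWeightCT L M β μ K (klScale klE0 n) k)) Qm p -
      klBubbleMass L M β μ K
        (fun k => ψ k + (hubbardCutoffWeightCT L M β μ K (klScale klE0 (n + 1)) k - hubbardCutoffWeightCT L M β μ K (klScale klE0 (n + 1)) k))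
        (fun k => ψ k + (hubbardCutoffWeightCT L M β μ K (klScale klE0 (n + 1)) k - hubbardCutoffWeightCT L M β μ K (klScale klE0 (n + 1)) k)) Qm p =
      klSliceWeightSmeared L M β μ K (n + 1) ψ Qm p := by
  rw [runningSymbol_at_upper, runningSymbol_at_lower, klSliceWeightSmeared, Nat.add_sub_cancel]

end Running

/-! ## §3 The RELATIVE rate of two members: lines of the difference symbol only, and its mass -/

section Relative

variable {L M : ℕ} (β μ : ℝ) (K : TrigPolyC4v)

/-- **The relative running weight's derivative**: for two members `ψ₁, ψ₂` with the SAME running shift,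
`d/dΛ [B(φ¹_Λ,φ¹_Λ) − B(φ²_Λ,φ²_Λ)] = −[B(ẇ_Λ, D) + B(D, ẇ_Λ)]`, `D = ψ₁ − ψ₂` — the relative rung has NO line of the common part. -/
theorem hasDerivAt_runningSmearedWeight_sub {Λ : ℝ} (hΛ : Λ ≠ 0) (Λ₁ : ℝ) (ψ₁ ψ₂ : FreqMomentum L M → ℝ) (Qm p : TorusSite 2 L) :
    HasDerivAt
      (fun Λ' =>
        klBubbleMass L M β μ K
            (fun k => ψ₁ k + (hubbardCutoffWeightCT L M β μ K Λ₁ k - hubbardCutoffWeightCT L M β μ K Λ' k))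
            (fun k => ψ₁ k + (hubbardCutoffWeightCT L M β μ K Λ₁ k - hubbardCutoffWeightCT L M β μ K Λ' k)) Qm p -
          klBubbleMass L M β μ K
            (fun k => ψ₂ k + (hubbardCutoffWeightCT L M β μ K Λ₁ k - hubbardCutoffWeightCT L M β μ K Λ' k))
            (fun k => ψ₂ k + (hubbardCutoffWeightCT L M β μ K Λ₁ k - hubbardCutoffWeightCT L M β μ K Λ' k)) Qm p)
      (-(klBubbleMass L M β μ K (fun k => deriv (fun Λ' => hubbardCutoffWeightCT L M β μ K Λ' k) Λ) (ψ₁ - ψ₂) Qm p +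
          klBubbleMass L M β μ K (ψ₁ - ψ₂) (fun k => deriv (fun Λ' => hubbardCutoffWeightCT L M β μ K Λ' k) Λ) Qm p)) Λ := by
  have h := (hasDerivAt_runningSmearedWeight β μ K hΛ Λ₁ ψ₁ Qm p).sub (hasDerivAt_runningSmearedWeight β μ K hΛ Λ₁ ψ₂ Qm p)
  refine h.congr_deriv ?_
  have hD : (ψ₁ - ψ₂ : FreqMomentum L M → ℝ) =
      (fun k => ψ₁ k + (hubbardCutoffWeightCT L M β μ K Λ₁ k - hubbardCutoffWeightCT L M β μ K Λ k)) -
        (fun k => ψ₂ k + (hubbardCutoffWeightCT L M β μ K Λ₁ k - hubbardCutoffWeightCT L M β μ K Λ k)) := by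
    funext k; simp
  rw [hD, sub_eq_add_neg (fun k => ψ₁ k + _) _, klBubbleMass_add_right, klBubbleMass_add_left,
    klBubbleMass_neg_right, klBubbleMass_neg_left]
  ring

variable [NeZero L]

omit [NeZero L] in
/-- **The derivative weight is a HARD line of the running shell**: `|ẇ_Λ(k)|·‖ĝ_K(k)‖ ≤ (128/3)/Λ²` (`0 < Λ`; `ẇ_Λ(k) ≠ 0` only on `Λ²/4 ≤ ω²+e_K² ≤ Λ²`, where
`‖ĝ_K‖ ≤ 2/Λ`, and `|ẇ_Λ| ≤ (64/3)/Λ`). -/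
theorem abs_derivWeight_mul_norm_propCT_le {Λ : ℝ} (hΛ : 0 < Λ) (k : FreqMomentum L M) :
    |deriv (fun Λ' => hubbardCutoffWeightCT L M β μ K Λ' k) Λ| * ‖propCT L M β μ K k‖ ≤ 128 / 3 / Λ ^ 2 := by
  by_cases hshell : matsubaraFreq β M k.1 ^ 2 + nambuXiCT L μ K k.2 ^ 2 < Λ ^ 2 / 4 ∨ Λ ^ 2 < matsubaraFreq β M k.1 ^ 2 + nambuXiCT L μ K k.2 ^ 2
  · rw [klws_deriv_cutoffWeight_scale_eq_zero L M β μ K hΛ.ne' k hshell, abs_zero, zero_mul]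
    positivity
  · push Not at hshell
    have hr : Λ ^ 2 / 4 ≤ matsubaraFreq β M k.1 ^ 2 + nambuXiCT L μ K k.2 ^ 2 := hshell.1
    have hg : ‖propCT L M β μ K k‖ ≤ 2 / Λ := by
      rw [norm_propCT_eq]
      have hsqrt : Λ / 2 ≤ Real.sqrt (matsubaraFreq β M k.1 ^ 2 + nambuXiCT L μ K k.2 ^ 2) := by
        rw [show Λ / 2 = Real.sqrt ((Λ / 2) ^ 2) from (Real.sqrt_sq (by positivity)).symm]
        exact Real.sqrt_le_sqrt (by linarith)
      calc (Real.sqrt (matsubaraFreq β M k.1 ^ 2 + nambuXiCT L μ K k.2 ^ 2))⁻¹ ≤ (Λ / 2)⁻¹ := inv_anti₀ (by positivity) hsqrt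
        _ = 2 / Λ := by rw [inv_div]
    have hd := klws_abs_deriv_cutoffWeight_scale_le L M β μ K hΛ.ne' k
    rw [abs_of_pos hΛ] at hd
    calc |deriv (fun Λ' => hubbardCutoffWeightCT L M β μ K Λ' k) Λ| * ‖propCT L M β μ K k‖ ≤ (64 / 3 / Λ) * (2 / Λ) :=
          mul_le_mul hd hg (norm_nonneg _) (by positivity)
      _ = 128 / 3 / Λ ^ 2 := by field_simp; ring

/-- **Mass of the RELATIVE rate**: `Σ_p |B(ẇ_Λ, D)(Qm,p) + B(D, ẇ_Λ)(Qm,p)| ≤ (βL²)⁻¹·((256/3)/Λ²)·Σ_k |D(k)|·‖ĝ_K(k)‖` for ANY real symbol `D` (`0 < β`, `0 < Λ`):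
integrable over the slice against `dΛ` (`∫ dΛ/Λ² = 1/Λ_{n+1} − 1/Λ_n`), giving the difference symbol's soft mass in units of the scale — the currency of `klSoftMass`. -/
theorem sum_abs_relativeRate_le_softSum (hβ : 0 < β) {Λ : ℝ} (hΛ : 0 < Λ) (D : FreqMomentum L M → ℝ) (Qm : TorusSite 2 L) :
    ∑ p, |klBubbleMass L M β μ K (fun k => deriv (fun Λ' => hubbardCutoffWeightCT L M β μ K Λ' k) Λ) D Qm p +
        klBubbleMass L M β μ K D (fun k => deriv (fun Λ' => hubbardCutoffWeightCT L M β μ K Λ' k) Λ) Qm p| ≤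
      (β * (L : ℝ) ^ 2)⁻¹ * (256 / 3 / Λ ^ 2) * ∑ k : FreqMomentum L M, |D k| * ‖propCT L M β μ K k‖ := by
  have hA := abs_derivWeight_mul_norm_propCT_le (L := L) (M := M) β μ K hΛ
  have h1 := sum_abs_klBubbleMass_le_of_left β μ K hβ D hA Qm
  have h2 := sum_abs_klBubbleMass_le_of_right β μ K hβ D hA Qm
  calc ∑ p, |klBubbleMass L M β μ K (fun k => deriv (fun Λ' => hubbardCutoffWeightCT L M β μ K Λ' k) Λ) D Qm p +
          klBubbleMass L M β μ K D (fun k => deriv (fun Λ' => hubbardCutoffWeightCT L M β μ K Λ' k) Λ) Qm p|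
      ≤ ∑ p, (|klBubbleMass L M β μ K (fun k => deriv (fun Λ' => hubbardCutoffWeightCT L M β μ K Λ' k) Λ) D Qm p| +
          |klBubbleMass L M β μ K D (fun k => deriv (fun Λ' => hubbardCutoffWeightCT L M β μ K Λ' k) Λ) Qm p|) :=
        sum_le_sum fun p _ => abs_add_le _ _
    _ ≤ (β * (L : ℝ) ^ 2)⁻¹ * (128 / 3 / Λ ^ 2) * ∑ k, |D k| * ‖propCT L M β μ K k‖ +
          (β * (L : ℝ) ^ 2)⁻¹ * (128 / 3 / Λ ^ 2) * ∑ k, |D k| * ‖propCT L M β μ K k‖ := by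
        rw [sum_add_distrib]; exact add_le_add h1 h2
    _ = (β * (L : ℝ) ^ 2)⁻¹ * (256 / 3 / Λ ^ 2) * ∑ k, |D k| * ‖propCT L M β μ K k‖ := by ring

end Relative

end Summit.HubbardSuperconductivity.HubbardSuperconductivity.Theorems.KLRegimeSplit

end
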